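import Summits.QuantumFields.BalabanUV.Beta.D1BFx.ScaleLegTermBound
import Summits.QuantumFields.BalabanUV.Beta.D1BFx.TwoPointEnds
import Summits.QuantumFields.BalabanUV.Beta.D1BFx.FrozenLegTails
import Summits.QuantumFields.BalabanUV.Beta.D1BFx.OffDiagonalLegGrade

/-!
# `BalabanUV.Beta.D1BFx.TwoPointLegRows` — road «BF-x» for binder row D1, «A3.c ∕ L-X TAILS» PART II (G): the ROWS of the ENTRIES of `K^∞` as
# two-point legs — far d0∕d1 for EVERY fibre entry at EITHER end (modulo the printed `h12`∕`h126`), soft forms, STATIC-end iterated differences,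
# and the slice dictionaries `itR`∕`itL` ↔ an3's `iterD`

HONEST DEPENDENCY (page 1, mandatory): continuum YM on T⁴ ⇐ BetaPertH ∧ nine spine estimates (0/9 proved); BetaPertH ⇐ (D1) ∧ (D4) ∧
CAP+tail; G-an2-4 gates asym, D1 and NE2/3/4.  HONEST FRAMING (cell contract, verbatim): «discharging `BetaPertH` makes Bałaban's UV
stability UNCONDITIONAL — a real constructive-QFT result; it is NOT the continuum limit and NOT the Clay problem.»  THIS MODULE DISCHARGES
NOTHING of the wall: §1 is this lineage's `FrozenLegTails.Kinf_rows_of_prop12` with the diagonal fibre pair `(κ, κ)` replaced by an arbitrary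
`(κ, l)` — a theorem MODULO the two PRINTED statements `B5.Prop12Printed`∕`B5.Kernel126_127Printed` taken BY NAME as hypotheses `h12`∕`h126`
(the gate records `conditional-result`; nothing printed is proved here); §§2–3 are [folklore] real inequalities about an ARBITRARY two-point
function `K : ℤ⁴ → ℤ⁴ → ℝ` under rows in that shape (slices via part (F1)'s `itL`∕`itR` dictionaries).  No `def`, no `Prop` minted, nothing cited
anew, 0 sorry.  0 wall binders; NOT an A3.c row, NOT (K), NOT D1, NOT `BetaPertH`, NOT continuum, NOT Clay.

ABSOLUTE RULE (cell charter, verbatim): «No internally-minted statement may enter as a cited fact. Every hypothesis is either kernel-proved in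
this package or a verbatim quotation of a PUBLISHED theorem with page reference. The manuscript(s) under audit are NOT citable for their own
disputed steps — they are the thing under adjudication; programme-internal (2001/route/tribunal) claims are never citable.»

WHY (this lineage's N-d1leaf03g12-2, journal [D1LEAF03-G12-STMT-B]): the A3.c legs `diagPart Ga − frozenLeg gfrz`, `offPart Ga` are ENTRIES
`K^∞((x,κ),(y,l))` of the infinite-volume gluon propagator; a vertex difference lands on ONE END of such an entry.  Part (H)'s count needs, per
entry slice `u ↦ K (x₀) (x₀ + u)` (second argument moving) and `u ↦ K (y₀ + u) (y₀)` (first argument moving), the soft far rows with exponent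
`2 + min(#steps, 1)` where steps at the STATIC end count like steps at the moving end (first-argument differences are second-argument differences of
the transposed entry, `Kinf_symm`).
* §1 **`Kinf_entry_rows_of_prop12`** — `∃ δ A₀ A₁, ∀ n b w κ l, w ≠ 0 → |K^∞((b,κ),(b+w,l))| ≤ A₀e^{−(δ/n)‖w‖∞}/‖w‖∞²` and the forward-step row in the
  second argument with `A₁` (an5's `VectorTailsPt.legs_pt_A` (.1)(.2.1) + `calG_re_tendsto_Kinf` + `Kinf_symm`).
* §2 [folklore] SOFT ROWS FROM A VALUE BOUND AT THE ORIGIN (`|K b b| ≤ Z`): `soft_d0_of_zero`, `soft_d1_of_zero`, `abs_fdiff_far_le_of_zero` (both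
  orientations), `abs_iterD_far_le_of_zero` (uniform shape `(5A₀ + 8A₁ + Z)·8e^δ(1+8e^δ)^k·E(u)/(‖u‖∞+1)^{2+min k 1}`) — part (B)∕(C2) with h0 replaced by `Z`.
* §3 [folklore] **`abs_itL_itR_slice_le`**: for a two-point `K` whose every base-point slice AND every transposed slice obeys d0∕d1 (`w ≠ 0`) and
  `|K x x| ≤ Z`: `|itL sL (itR sR K) x₀ (x₀ + u)| ≤ (5A₀+8A₁+Z)·8e^δ·(1+8e^δ)^{|sL|+|sR|}·E(u)/(‖u‖∞+1)^{2+min(|sL|+|sR|) 1}` — static and moving steps alike.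
Unit `b2b-balaban-beta-d1-formalise-leaf-03` (gen 12), D1 formalisation swarm; `LEAVES-BFx.md` row «A3.c ∕ L-X TAILS» PART II (G).
-/

noncomputable section

namespace Summit.QuantumFields.BalabanUV.Beta.D1BFx.TwoPointLegRows

open Filter Topology
open Literature.MathematicalPhysics.QuantumFieldTheory.Balaban1983to89
open Literature.MathematicalPhysics.QuantumFieldTheory.Balaban1983to89.Beta
open B5Prop11Plancherel (calG fine Tor)
open DyadicShell (Pt supNorm supNorm_eq_zero_iff)
open BubbleTransfer (unitVec)
open VectorTails (castT castT_add)
open VectorTailsPt (rd rdM InBox legs_pt_A eventually_inBox abs_re_le)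
open VectorTailsLoc (fam kfam)
open VectorPropagatorLimit (Kinf calG_re_tendsto_Kinf Kinf_symm)
open BlockKernelVolumeSockets (evenPeriod)
open FreeLegDictionary (cubic)
open GradedBubbles (Fam fdiffF iterD IsStep supNorm_neg)
open TwoPowerLegs (supNorm_unitVec)
open ScaleLegRows (abs_shift_le_soft supNorm_of_isStep abs_iterD_const_le_soft iterD_const_cons)
open TwoPointEnds (SKer shL shR itL itR itR_diffL itR_slice itL_slice itL_itR_comm itL_eq_itR_transpose)
open Summit.QuantumFields.BalabanUV.Beta.D1BFx.FrozenLegTails (nOf MOf hn1 sides_tendsto)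

/-! ## §1 The rows of EVERY entry of `K^∞`, modulo the printed statements -/

/-- **THE VALUE AND SECOND-ARGUMENT DIFFERENCE ROWS OF EVERY ENTRY OF `K^∞`, MODULO [B5, Prop. 1.2 (1.110)–(1.114)] AND [B5, (1.126)–(1.127)] BY
NAME**: one rate `δ > 0` and constants `A₀, A₁ ≥ 0` — chosen before the scale, the base point, the fibre pair and the displacement — with, for every
`n ≥ 1`, `b, w ∈ ℤ⁴`, `w ≠ 0`, `κ, l`: `|K^∞((b,κ),(b+w,l))| ≤ A₀e^{−(δ/n)‖w‖∞}/‖w‖∞²` and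
`|K^∞((b,κ),(b+w+e_ρ,l)) − K^∞((b,κ),(b+w,l))| ≤ A₁e^{−(δ/n)‖w‖∞}/‖w‖∞³` (every `ρ`).  Proof: an5's `VectorTailsPt.legs_pt_A` for the reading
`rd … l κ` (torus rows, uniformly in the volume, inside the faithful box) + `eventually_inBox` + the entrywise limit `calG_re_tendsto_Kinf` + `Kinf_symm` —
this lineage's `FrozenLegTails.Kinf_rows_of_prop12` with `(κ, κ) ↦ (κ, l)`. -/
theorem Kinf_entry_rows_of_prop12 (a : ℝ) (ha : 0 < a) (h12 : B5.Prop12Printed (fam nOf hn1 MOf a ha)) (h126 : B5.Kernel126_127Printed (kfam nOf MOf)) :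
    ∃ δ A₀ A₁ : ℝ, 0 < δ ∧ 0 ≤ A₀ ∧ 0 ≤ A₁ ∧
      ∀ (n : ℕ) [NeZero n] (b w : Pt) (κ l : Fin 4), w ≠ 0 →
        |Kinf n a (b, κ) (b + w, l)| ≤ A₀ * Real.exp (-(δ / n) * supNorm w) / (supNorm w : ℝ) ^ 2 ∧
        ∀ ρ : Fin 4, |Kinf n a (b, κ) (b + w + unitVec ρ, l) - Kinf n a (b, κ) (b + w, l)| ≤
          A₁ * Real.exp (-(δ / n) * supNorm w) / (supNorm w : ℝ) ^ 3 := by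
  obtain ⟨δ, A, hδ, hA, h⟩ := legs_pt_A nOf hn1 MOf a ha h12 h126
  refine ⟨δ, A 0, A 1, hδ, hA 0, hA 1, fun n _ b w κ l hw => ?_⟩
  have hn : 1 ≤ n := Nat.one_le_iff_ne_zero.mpr (NeZero.ne n)
  have hbox : ∀ᶠ t : ℕ in atTop, InBox (fine n (cubic 4 (evenPeriod t))) w :=
    eventually_inBox nOf MOf (l := atTop) (fun t : ℕ => ((⟨n, hn⟩ : ℕ+), t)) (sides_tendsto ⟨n, hn⟩) w
  have key : ∀ t : ℕ, InBox (fine n (cubic 4 (evenPeriod t))) w →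
      |rd n hn (cubic 4 (evenPeriod t)) a ha (castT _ b) l κ Complex.reAddGroupHom w| ≤
          A 0 * Real.exp (-(δ / n) * supNorm w) / (supNorm w : ℝ) ^ 2 ∧
      ∀ ρ : Fin 4, |rd n hn (cubic 4 (evenPeriod t)) a ha (castT _ b) l κ Complex.reAddGroupHom (w + unitVec ρ) -
          rd n hn (cubic 4 (evenPeriod t)) a ha (castT _ b) l κ Complex.reAddGroupHom w| ≤
          A 1 * Real.exp (-(δ / n) * supNorm w) / (supNorm w : ℝ) ^ 3 := by
    intro t ht
    have h' := h ((⟨n, hn⟩ : ℕ+), t) (castT _ b) l κ Complex.reAddGroupHom abs_re_le w hw ht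
    exact ⟨h'.1, h'.2.1⟩
  have erd : ∀ (t : ℕ) (v : Pt), rd n hn (cubic 4 (evenPeriod t)) a ha (castT _ b) l κ Complex.reAddGroupHom v =
      ((n : ℕ) : ℝ) ^ 2 * (calG n hn (cubic 4 (evenPeriod t)) a ha (castT (fine n (cubic 4 (evenPeriod t))) (b + v), l)
        (castT (fine n (cubic 4 (evenPeriod t))) b, κ)).re := by
    intro t v
    simp only [rd, rdM, VectorLegVolumeAdapter.re_apply, castT_add]
  have lim0 : Tendsto (fun t => rd n hn (cubic 4 (evenPeriod t)) a ha (castT _ b) l κ Complex.reAddGroupHom w) atTop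
      (𝓝 (Kinf n a (b + w, l) (b, κ))) := by
    simp only [erd]
    exact calG_re_tendsto_Kinf n hn a ha (by norm_num) (b + w) b l κ
  have lim1 : ∀ ρ : Fin 4, Tendsto (fun t => rd n hn (cubic 4 (evenPeriod t)) a ha (castT _ b) l κ Complex.reAddGroupHom (w + unitVec ρ) -
      rd n hn (cubic 4 (evenPeriod t)) a ha (castT _ b) l κ Complex.reAddGroupHom w) atTop
      (𝓝 (Kinf n a (b + w + unitVec ρ, l) (b, κ) - Kinf n a (b + w, l) (b, κ))) := by
    intro ρ
    simp only [erd]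
    rw [show Kinf n a (b + w + unitVec ρ, l) (b, κ) = Kinf n a (b + (w + unitVec ρ), l) (b, κ) by rw [add_assoc]]
    exact (calG_re_tendsto_Kinf n hn a ha (by norm_num) (b + (w + unitVec ρ)) b l κ).sub
      (calG_re_tendsto_Kinf n hn a ha (by norm_num) (b + w) b l κ)
  have hsymm : ∀ x : Pt, Kinf n a (x, l) (b, κ) = Kinf n a (b, κ) (x, l) := fun x =>
    Kinf_symm n hn a ha (by norm_num) (x, l) (b, κ)
  refine ⟨?_, fun ρ => ?_⟩
  · rw [← hsymm]
    exact le_of_tendsto lim0.abs (hbox.mono fun t ht => (key t ht).1)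
  · rw [← hsymm (b + w + unitVec ρ), ← hsymm (b + w)]
    exact le_of_tendsto (lim1 ρ).abs (hbox.mono fun t ht => (key t ht).2 ρ)

/-! ## §2 Soft rows of a one-variable slice from d0∕d1 and a value bound at the origin -/

section Soft

variable {n : ℕ} {δ A₀ A₁ Z : ℝ} {g : Pt → ℝ}

/-- [folklore] **SOFT ROW d0 FROM A VALUE BOUND**: d0 off the origin and `|g 0| ≤ Z` ⇒ `|g v| ≤ (4A₀ + Z)·E(v)/(‖v‖∞+1)²` for ALL `v`
(part (B)'s `soft_d0` with h0 replaced by the value bound). -/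
theorem soft_d0_of_zero (hA₀ : 0 ≤ A₀) (hz : |g 0| ≤ Z)
    (d0 : ∀ v : Pt, v ≠ 0 → |g v| ≤ A₀ * Real.exp (-(δ / n) * supNorm v) / (supNorm v : ℝ) ^ 2) (v : Pt) :
    |g v| ≤ (4 * A₀ + Z) * Real.exp (-(δ / n) * supNorm v) / ((supNorm v : ℝ) + 1) ^ 2 := by
  have hZ : 0 ≤ Z := (abs_nonneg _).trans hz
  by_cases hv : v = 0
  · subst hv
    have hs : (supNorm (0 : Pt) : ℝ) = 0 := by exact_mod_cast supNorm_eq_zero_iff.mpr rfl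
    rw [hs, mul_zero, Real.exp_zero, zero_add, one_pow, mul_one, div_one]
    linarith
  · have hs1 : (1 : ℝ) ≤ supNorm v := BubbleTransfer.Leg.one_le_supNorm hv
    set s : ℝ := (supNorm v : ℝ)
    set E : ℝ := Real.exp (-(δ / n) * s)
    have hE0 : 0 < E := Real.exp_pos _
    refine (d0 v hv).trans ?_
    rw [div_le_div_iff₀ (by positivity) (by positivity)]
    have h4 : (s + 1) ^ 2 ≤ 4 * s ^ 2 := by
      have h2 : s + 1 ≤ 2 * s := by linarith
      calc (s + 1) ^ 2 ≤ (2 * s) ^ 2 := pow_le_pow_left₀ (by positivity) h2 2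
        _ = 4 * s ^ 2 := by ring
    calc A₀ * E * (s + 1) ^ 2 ≤ A₀ * E * (4 * s ^ 2) := by gcongr
      _ = 4 * A₀ * E * s ^ 2 := by ring
      _ ≤ (4 * A₀ + Z) * E * s ^ 2 := by gcongr; linarith

/-- [folklore] **SOFT ROW d1 FROM A VALUE BOUND**: `|g (v + e_ρ) − g v| ≤ (8A₁ + A₀ + Z)·E(v)/(‖v‖∞+1)³` for ALL `v`. -/
theorem soft_d1_of_zero (hn : 1 ≤ n) (hδ : 0 ≤ δ) (hA₀ : 0 ≤ A₀) (hA₁ : 0 ≤ A₁) (hz : |g 0| ≤ Z)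
    (d0 : ∀ v : Pt, v ≠ 0 → |g v| ≤ A₀ * Real.exp (-(δ / n) * supNorm v) / (supNorm v : ℝ) ^ 2)
    (d1 : ∀ v : Pt, v ≠ 0 → ∀ ρ : Fin 4, |g (v + unitVec ρ) - g v| ≤ A₁ * Real.exp (-(δ / n) * supNorm v) / (supNorm v : ℝ) ^ 3)
    (v : Pt) (ρ : Fin 4) :
    |g (v + unitVec ρ) - g v| ≤ (8 * A₁ + (A₀ + Z)) * Real.exp (-(δ / n) * supNorm v) / ((supNorm v : ℝ) + 1) ^ 3 := by
  have hZ : 0 ≤ Z := (abs_nonneg _).trans hz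
  have hnpos : (0 : ℝ) < n := by exact_mod_cast (show 0 < n by omega)
  by_cases hv : v = 0
  · subst hv
    have hs : (supNorm (0 : Pt) : ℝ) = 0 := by exact_mod_cast supNorm_eq_zero_iff.mpr rfl
    rw [hs, mul_zero, Real.exp_zero]
    simp only [zero_add, one_pow, mul_one, div_one]
    have hne : (unitVec ρ : Pt) ≠ 0 := by
      intro h
      have h1 := supNorm_unitVec ρ
      rw [h, supNorm_eq_zero_iff.mpr rfl] at h1
      exact absurd h1 (by norm_num)
    have he : |g (unitVec ρ)| ≤ A₀ := by
      refine (d0 _ hne).trans ?_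
      rw [supNorm_unitVec, Nat.cast_one, one_pow, div_one]
      have : Real.exp (-(δ / n) * (1 : ℝ)) ≤ 1 := Real.exp_le_one_iff.mpr (by have := div_nonneg hδ hnpos.le; linarith)
      exact (mul_le_mul_of_nonneg_left this hA₀).trans (by rw [mul_one])
    calc |g (unitVec ρ) - g 0| ≤ |g (unitVec ρ)| + |g 0| := abs_sub _ _
      _ ≤ A₀ + Z := add_le_add he hz
      _ ≤ 8 * A₁ + (A₀ + Z) := by linarith
  · have hs1 : (1 : ℝ) ≤ supNorm v := BubbleTransfer.Leg.one_le_supNorm hv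
    set s : ℝ := (supNorm v : ℝ)
    set E : ℝ := Real.exp (-(δ / n) * s)
    have hE0 : 0 < E := Real.exp_pos _
    refine (d1 v hv ρ).trans ?_
    rw [div_le_div_iff₀ (by positivity) (by positivity)]
    have h8 : (s + 1) ^ 3 ≤ 8 * s ^ 3 := by
      have h2 : s + 1 ≤ 2 * s := by linarith
      calc (s + 1) ^ 3 ≤ (2 * s) ^ 3 := pow_le_pow_left₀ (by positivity) h2 3
        _ = 8 * s ^ 3 := by ring
    calc A₁ * E * (s + 1) ^ 3 ≤ A₁ * E * (8 * s ^ 3) := by gcongr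
      _ = 8 * A₁ * E * s ^ 3 := by ring
      _ ≤ (8 * A₁ + (A₀ + Z)) * E * s ^ 3 := by gcongr; linarith

/-- [folklore] One unit difference of `g`, BOTH orientations, soft form: `≤ 8e^δ·(8A₁ + A₀ + Z)·E(v)/(‖v‖∞+1)³`. -/
theorem abs_fdiff_far_le_of_zero (hn : 1 ≤ n) (hδ : 0 ≤ δ) (hA₀ : 0 ≤ A₀) (hA₁ : 0 ≤ A₁) (hz : |g 0| ≤ Z)
    (d0 : ∀ v : Pt, v ≠ 0 → |g v| ≤ A₀ * Real.exp (-(δ / n) * supNorm v) / (supNorm v : ℝ) ^ 2)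
    (d1 : ∀ v : Pt, v ≠ 0 → ∀ ρ : Fin 4, |g (v + unitVec ρ) - g v| ≤ A₁ * Real.exp (-(δ / n) * supNorm v) / (supNorm v : ℝ) ^ 3)
    {e : Pt} (he : IsStep e) (v : Pt) :
    |g (v + e) - g v| ≤ (8 * A₁ + (A₀ + Z)) * (8 * Real.exp δ) * Real.exp (-(δ / n) * supNorm v) / ((supNorm v : ℝ) + 1) ^ 3 := by
  have hZ : 0 ≤ Z := (abs_nonneg _).trans hz
  have hB : 0 ≤ 8 * A₁ + (A₀ + Z) := by positivity
  have hsoft := soft_d1_of_zero hn hδ hA₀ hA₁ hz d0 d1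
  obtain ⟨ρ, rfl | rfl⟩ := he
  · refine (hsoft v ρ).trans ?_
    rw [div_le_div_iff_of_pos_right (by positivity)]
    refine mul_le_mul_of_nonneg_right ?_ (Real.exp_pos _).le
    have : (1 : ℝ) ≤ 8 * Real.exp δ := by have := Real.one_le_exp hδ; linarith
    exact le_mul_of_one_le_right hB this
  · rw [ScaleLegRows.diff_neg_unitVec g v ρ, abs_neg]
    have hneg : IsStep (-unitVec ρ : Pt) := ⟨ρ, Or.inr rfl⟩
    have h := abs_shift_le_soft hn hδ hB (p := 3) (ψ := fun u => g (u + unitVec ρ) - g u) (fun u => hsoft u ρ) v (-unitVec ρ)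
    rw [supNorm_of_isStep hneg, mul_one, show ((1 : ℝ) + 1) ^ 3 = 8 by norm_num] at h
    refine h.trans (le_of_eq ?_)
    ring

/-- [folklore] **ITERATED UNIT DIFFERENCES, UNIFORM SHAPE, FROM A VALUE BOUND**:
`|∂^{as}g (u)| ≤ (5A₀ + 8A₁ + Z)·8e^δ·(1+8e^δ)^{|as|}·E(u)/(‖u‖∞+1)^{2 + min |as| 1}`. -/
theorem abs_iterD_far_le_of_zero (hn : 1 ≤ n) (hδ : 0 ≤ δ) (hA₀ : 0 ≤ A₀) (hA₁ : 0 ≤ A₁) (hz : |g 0| ≤ Z)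
    (d0 : ∀ v : Pt, v ≠ 0 → |g v| ≤ A₀ * Real.exp (-(δ / n) * supNorm v) / (supNorm v : ℝ) ^ 2)
    (d1 : ∀ v : Pt, v ≠ 0 → ∀ ρ : Fin 4, |g (v + unitVec ρ) - g v| ≤ A₁ * Real.exp (-(δ / n) * supNorm v) / (supNorm v : ℝ) ^ 3)
    {as : List Pt} (has : ∀ e ∈ as, IsStep e) (u : Pt) :
    |iterD as (fun (_ : ℕ) (_ : ℕ) => g) 0 0 u| ≤
      (5 * A₀ + 8 * A₁ + Z) * (8 * Real.exp δ) * (1 + 2 ^ 3 * Real.exp δ) ^ as.length *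
        Real.exp (-(δ / n) * supNorm u) / ((supNorm u : ℝ) + 1) ^ (2 + min as.length 1) := by
  have hZ : 0 ≤ Z := (abs_nonneg _).trans hz
  have he : (1 : ℝ) ≤ 8 * Real.exp δ := by have := Real.one_le_exp hδ; linarith
  have hq : (1 : ℝ) ≤ 1 + 2 ^ 3 * Real.exp δ := by have := Real.exp_pos δ; linarith
  set E : ℝ := Real.exp (-(δ / n) * supNorm u) with hE
  have hE0 : 0 < E := Real.exp_pos _
  cases as with
  | nil =>
      have h0 := soft_d0_of_zero (n := n) (δ := δ) hA₀ hz d0 u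
      simp only [iterD, List.length_nil, pow_zero, mul_one, Nat.min_eq_left (Nat.zero_le 1), add_zero]
      refine h0.trans ?_
      rw [div_le_div_iff_of_pos_right (by positivity)]
      refine mul_le_mul_of_nonneg_right ?_ hE0.le
      calc 4 * A₀ + Z ≤ (5 * A₀ + 8 * A₁ + Z) * 1 := by linarith
        _ ≤ (5 * A₀ + 8 * A₁ + Z) * (8 * Real.exp δ) := mul_le_mul_of_nonneg_left he (by positivity)
  | cons e as =>
      rw [iterD_const_cons]
      have hB : 0 ≤ (8 * A₁ + (A₀ + Z)) * (8 * Real.exp δ) := by positivity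
      have h1 := abs_iterD_const_le_soft hn hδ hB (fun v => abs_fdiff_far_le_of_zero hn hδ hA₀ hA₁ hz d0 d1 (has e (by simp)) v)
        (fun b hb => has b (List.mem_cons_of_mem e hb)) u
      refine h1.trans ?_
      simp only [List.length_cons, show min (as.length + 1) 1 = 1 by omega]
      rw [div_le_div_iff_of_pos_right (by positivity), pow_succ]
      refine mul_le_mul_of_nonneg_right ?_ hE0.le
      have h2 : (8 * A₁ + (A₀ + Z)) * (8 * Real.exp δ) ≤ (5 * A₀ + 8 * A₁ + Z) * (8 * Real.exp δ) :=
        mul_le_mul_of_nonneg_right (by linarith) (by positivity)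
      have h3 : (1 + 2 ^ 3 * Real.exp δ) ^ as.length ≤ (1 + 2 ^ 3 * Real.exp δ) ^ as.length * (1 + 2 ^ 3 * Real.exp δ) :=
        le_mul_of_one_le_right (by positivity) hq
      exact mul_le_mul h2 h3 (by positivity) (by positivity)

end Soft

/-! ## §3 A two-point kernel with rows at every base point and at both ends: soft far bound of its static + moving differences -/

section TwoPoint

variable {n : ℕ} {δ A₀ A₁ Z B : ℝ} {p : ℕ} {K : SKer}

/-- [folklore] **ONE STATIC STEP ON A TWO-POINT FUNCTION WITH UNIFORM SLICE BOUNDS** keeps the shape: if `|K' x (x+v)| ≤ B·E(v)/(‖v‖∞+1)^p` for all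
`x, v`, then the first-argument difference `K'(x+e,·) − K'(x,·)` obeys the same with `B(1 + 2^p e^δ)` (unit `e`; transport from the base point `x+e`). -/
theorem abs_diffL_slice_le (hn : 1 ≤ n) (hδ : 0 ≤ δ) (hB : 0 ≤ B) {K' : SKer}
    (h : ∀ (x v : Pt), |K' x (x + v)| ≤ B * Real.exp (-(δ / n) * supNorm v) / ((supNorm v : ℝ) + 1) ^ p) {e : Pt} (he : IsStep e) (x v : Pt) :
    |K' (x + e) (x + v) - K' x (x + v)| ≤ B * (1 + 2 ^ p * Real.exp δ) * Real.exp (-(δ / n) * supNorm v) / ((supNorm v : ℝ) + 1) ^ p := by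
  have hneg : IsStep (-e) := he.neg
  have h1 : |K' (x + e) (x + v)| ≤ B * (Real.exp δ * 2 ^ p) * Real.exp (-(δ / n) * supNorm v) / ((supNorm v : ℝ) + 1) ^ p := by
    have hs := abs_shift_le_soft hn hδ hB (p := p) (ψ := fun t => K' (x + e) (x + e + t)) (fun t => h (x + e) t) v (-e)
    rw [supNorm_of_isStep hneg, mul_one, show ((1 : ℝ) + 1) = 2 by norm_num, show x + e + (v + -e) = x + v by abel] at hs
    exact hs
  have h2 := h x v
  set E : ℝ := Real.exp (-(δ / n) * supNorm v)
  set D : ℝ := ((supNorm v : ℝ) + 1) ^ p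
  have hD : 0 < D := by positivity
  calc |K' (x + e) (x + v) - K' x (x + v)| ≤ |K' (x + e) (x + v)| + |K' x (x + v)| := abs_sub _ _
    _ ≤ B * (Real.exp δ * 2 ^ p) * E / D + B * E / D := add_le_add h1 h2
    _ = B * (1 + 2 ^ p * Real.exp δ) * E / D := by
        field_simp
        ring

/-- [folklore] **ITERATED STATIC STEPS** on a two-point function with uniform slice bounds: constant `× (1 + 2^p e^δ)^{|sL|}`. -/
theorem abs_itL_slice_le (hn : 1 ≤ n) (hδ : 0 ≤ δ) (hB : 0 ≤ B) {K' : SKer}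
    (h : ∀ (x v : Pt), |K' x (x + v)| ≤ B * Real.exp (-(δ / n) * supNorm v) / ((supNorm v : ℝ) + 1) ^ p) {sL : List Pt} (hsL : ∀ e ∈ sL, IsStep e)
    (x v : Pt) :
    |itL sL K' x (x + v)| ≤ B * (1 + 2 ^ p * Real.exp δ) ^ sL.length * Real.exp (-(δ / n) * supNorm v) / ((supNorm v : ℝ) + 1) ^ p := by
  induction sL generalizing K' B x with
  | nil => simpa [itL] using h x v
  | cons e sL ih =>
      show |itL sL (fun x y => K' (x + e) y - K' x y) x (x + v)| ≤ _
      rw [List.length_cons, pow_succ]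
      have hB' : 0 ≤ B * (1 + 2 ^ p * Real.exp δ) := by positivity
      have h' : ∀ (x v : Pt), |(fun x y => K' (x + e) y - K' x y) x (x + v)| ≤
          B * (1 + 2 ^ p * Real.exp δ) * Real.exp (-(δ / n) * supNorm v) / ((supNorm v : ℝ) + 1) ^ p :=
        fun x v => abs_diffL_slice_le hn hδ hB h (hsL e (by simp)) x v
      have := ih (K' := fun x y => K' (x + e) y - K' x y) hB' h' (fun b hb => hsL b (List.mem_cons_of_mem e hb)) x
      calc |itL sL (fun x y => K' (x + e) y - K' x y) x (x + v)|
          ≤ B * (1 + 2 ^ p * Real.exp δ) * (1 + 2 ^ p * Real.exp δ) ^ sL.length * Real.exp (-(δ / n) * supNorm v) / ((supNorm v : ℝ) + 1) ^ p := this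
        _ = B * ((1 + 2 ^ p * Real.exp δ) ^ sL.length * (1 + 2 ^ p * Real.exp δ)) * Real.exp (-(δ / n) * supNorm v) / ((supNorm v : ℝ) + 1) ^ p := by
            ring

/-- [folklore] **STATIC AND MOVING STEPS ALIKE.**  If every second-argument slice `u ↦ K x (x+u)` AND every first-argument slice `u ↦ K (y+u) y` of a
two-point function obeys d0∕d1 (off the origin) with `(δ, A₀, A₁)`, and `|K x x| ≤ Z` on the diagonal, then for unit steps `sL` on the first
argument and `sR` on the second,
`|itL sL (itR sR K) x₀ (x₀ + u)| ≤ (5A₀+8A₁+Z)·8e^δ·(1+8e^δ)^{|sL|+|sR|}·E(u)/(‖u‖∞+1)^{2 + min(|sL|+|sR|) 1}`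
for every `x₀, u` — the FIRST static step earns the same power as a moving step (it is a step of the first-argument slice at the far base point). -/
theorem abs_itL_itR_slice_le (hn : 1 ≤ n) (hδ : 0 ≤ δ) (hA₀ : 0 ≤ A₀) (hA₁ : 0 ≤ A₁)
    (hz : ∀ x : Pt, |K x x| ≤ Z)
    (d0 : ∀ (x v : Pt), v ≠ 0 → |K x (x + v)| ≤ A₀ * Real.exp (-(δ / n) * supNorm v) / (supNorm v : ℝ) ^ 2)
    (d1 : ∀ (x v : Pt), v ≠ 0 → ∀ ρ : Fin 4, |K x (x + v + unitVec ρ) - K x (x + v)| ≤ A₁ * Real.exp (-(δ / n) * supNorm v) / (supNorm v : ℝ) ^ 3)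
    (d0' : ∀ (y v : Pt), v ≠ 0 → |K (y + v) y| ≤ A₀ * Real.exp (-(δ / n) * supNorm v) / (supNorm v : ℝ) ^ 2)
    (d1' : ∀ (y v : Pt), v ≠ 0 → ∀ ρ : Fin 4, |K (y + v + unitVec ρ) y - K (y + v) y| ≤ A₁ * Real.exp (-(δ / n) * supNorm v) / (supNorm v : ℝ) ^ 3)
    {sL sR : List Pt} (hsL : ∀ e ∈ sL, IsStep e) (hsR : ∀ e ∈ sR, IsStep e) (x₀ u : Pt) :
    |itL sL (itR sR K) x₀ (x₀ + u)| ≤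
      (5 * A₀ + 8 * A₁ + Z) * (8 * Real.exp δ) * (1 + 2 ^ 3 * Real.exp δ) ^ (sL.length + sR.length) *
        Real.exp (-(δ / n) * supNorm u) / ((supNorm u : ℝ) + 1) ^ (2 + min (sL.length + sR.length) 1) := by
  have hZ : 0 ≤ Z := (abs_nonneg _).trans (hz 0)
  have he8 : (1 : ℝ) ≤ 8 * Real.exp δ := by have := Real.one_le_exp hδ; linarith
  have hq : (1 : ℝ) ≤ 1 + 2 ^ 3 * Real.exp δ := by have := Real.exp_pos δ; linarith
  set C : ℝ := (5 * A₀ + 8 * A₁ + Z) * (8 * Real.exp δ) with hC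
  have hC0 : 0 ≤ C := by positivity
  set E : ℝ := Real.exp (-(δ / n) * supNorm u) with hE
  have hE0 : 0 < E := Real.exp_pos _
  rcases sR with _ | ⟨e, sR'⟩
  · -- no moving step: `itR [] K = K`
    rcases sL with _ | ⟨e', sL'⟩
    · -- nothing at all: soft d0
      have h0 := soft_d0_of_zero (n := n) (δ := δ) hA₀ (by simpa using hz x₀) (d0 x₀) u
      simp only [itL, itR, List.length_nil, add_zero, pow_zero, mul_one, Nat.min_eq_left (Nat.zero_le 1)]
      refine h0.trans ?_
      rw [div_le_div_iff_of_pos_right (by positivity)]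
      refine mul_le_mul_of_nonneg_right ?_ hE0.le
      calc 4 * A₀ + Z ≤ (5 * A₀ + 8 * A₁ + Z) * 1 := by linarith
        _ ≤ C := mul_le_mul_of_nonneg_left he8 (by positivity)
    · -- first static step at exponent 3 (a step of the first-argument slice at the far base point), the rest crude
      simp only [itR, List.length_cons, List.length_nil, add_zero, show min (sL'.length + 1) 1 = 1 by omega]
      show |itL sL' (fun x y => K (x + e') y - K x y) x₀ (x₀ + u)| ≤ _
      have he' : IsStep e' := hsL e' (by simp)
      set B₁ : ℝ := (8 * A₁ + (A₀ + Z)) * (8 * Real.exp δ) with hB₁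
      have hB₁0 : 0 ≤ B₁ := by positivity
      have h1 : ∀ (x v : Pt), |(fun x y => K (x + e') y - K x y) x (x + v)| ≤ B₁ * Real.exp (-(δ / n) * supNorm v) / ((supNorm v : ℝ) + 1) ^ 3 := by
        intro x v
        have hsl := abs_fdiff_far_le_of_zero hn hδ hA₀ hA₁ (g := fun t => K (x + v + t) (x + v)) (by simpa using hz (x + v)) (d0' (x + v))
          (fun w hw ρ => by have h := d1' (x + v) w hw ρ; simp only [add_assoc] at h ⊢; exact h) he' (-v)
        simp only [supNorm_neg] at hsl
        have e1 : x + v + (-v + e') = x + e' := by abel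
        have e2 : x + v + -v = x := by abel
        rw [e1, e2] at hsl
        exact hsl
      have h2 := abs_itL_slice_le hn hδ hB₁0 (p := 3) (K' := fun x y => K (x + e') y - K x y) h1
        (fun b hb => hsL b (List.mem_cons_of_mem e' hb)) x₀ u
      refine h2.trans ?_
      rw [div_le_div_iff_of_pos_right (by positivity), pow_succ]
      refine mul_le_mul_of_nonneg_right ?_ hE0.le
      have h3 : B₁ ≤ C := mul_le_mul_of_nonneg_right (by linarith) (by positivity)
      have h4 : (1 + 2 ^ 3 * Real.exp δ) ^ sL'.length ≤ (1 + 2 ^ 3 * Real.exp δ) ^ sL'.length * (1 + 2 ^ 3 * Real.exp δ) :=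
        le_mul_of_one_le_right (by positivity) hq
      exact mul_le_mul h3 h4 (by positivity) hC0
  · -- at least one moving step: exponent 3 from the moving steps, all static steps crude
    have hR : ∀ (x v : Pt), |itR (e :: sR') K x (x + v)| ≤
        C * (1 + 2 ^ 3 * Real.exp δ) ^ (sR'.length + 1) * Real.exp (-(δ / n) * supNorm v) / ((supNorm v : ℝ) + 1) ^ 3 := by
      intro x v
      rw [itR_slice]
      have h := abs_iterD_far_le_of_zero hn hδ hA₀ hA₁ (g := fun t => K x (x + t)) (by simpa using hz x) (d0 x)
        (fun w hw ρ => by have h := d1 x w hw ρ; simp only [add_assoc] at h ⊢; exact h) hsR v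
      simp only [List.length_cons, show min (sR'.length + 1) 1 = 1 by omega] at h
      exact h
    have h2 := abs_itL_slice_le hn hδ (by positivity : 0 ≤ C * (1 + 2 ^ 3 * Real.exp δ) ^ (sR'.length + 1)) (p := 3) (K' := itR (e :: sR') K)
      hR hsL x₀ u
    refine h2.trans (le_of_eq ?_)
    have hmin : 2 + min (sL.length + (e :: sR').length) 1 = 3 := by simp only [List.length_cons]; omega
    have hlen : sL.length + (e :: sR').length = (sR'.length + 1) + sL.length := by simp only [List.length_cons]; omega
    rw [hmin, hlen, pow_add]
    ring

end TwoPoint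

end Summit.QuantumFields.BalabanUV.Beta.D1BFx.TwoPointLegRows

end
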